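import Summits.Schanuel.Schanuel.Theorems.ZilberEacBranchPoleFibrePoints
import Summits.Schanuel.Schanuel.Theorems.ZilberEacPowerCurveConstFibre
import HarnessLib

/-!
# Arbitrary base branches, XXXII: POLE and ZERO fibre values are dense in a good direction —
# growth `|Re x₁| ≍ n^{M/k}` along the exponential points of file XXXI

HONEST FRAMING.  Cell `pub-schanuel` (Zilber's Exponential-Algebraic Closedness, case ladder;
host summit Schanuel), seat 2, gen 29.  File XXXI produced, on the sheet with tangent `z`
(`z^k = 2πi`) of a base branch `x₀ = s^{-k}`, `x₁ = Φ(s)s^{-M}` carrying the fibre value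
`y₀ = ψ(s)s^L` (`L ∈ ℤ`, `ψ(0) ≠ 0`), exponential points `s_j = z^{-1}e^{−log n_j/k}u_j`, `u_j → 1`.
Along them `x₁ = e^{(M/k) log n_j}·Φ(s_j)z^M u_j^{-M}`, so `Re x₁ = n_j^{M/k}(Re(Φ(0)z^M) + o(1))`
while `log ‖x₁‖ = O(log n_j)`: THEOREM G (`unprojectedDense_of_growth`) applies as soon as
`Re(Φ(0)z^M) ≠ 0` for SOME root `z` — **`unprojectedDense_branch_poleFibre_of_exists_direction`**
(all `k, M ≥ 1`, every `L ∈ ℤ`) — and with no direction condition at all when `k ∤ 2M`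
(**`unprojectedDense_branch_poleFibre_of_not_dvd`**, file XIX's `exists_direction_of_not_dvd`).
Two tools for the next file are recorded here as well: a second-order Taylor bound
(`exists_taylor_two_bound`) and the growth ratio from exponential bounds
(`tendsto_growth_ratio_of_exp_bounds`).
For `L = 0` this re-proves file XIX by the soft route; the point is `L ≠ 0`: pole and zero fibre
values — e.g. every polynomial graph fibre `y₀ = R(x₀, x₁)` at a place at infinity of the base
curve where `R` has a pole — were not covered by any previous file (the analytic chart of file I
needs `ψ(0)` finite and nonzero).  What remains OPEN for such fibres: the residue class
`k ∣ 2M ∧ 2M/k ≡ 2 (mod 4)` with `Φ(0)` real (there the `L log s` term gives growth of order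
`n^{M/k−1} log n` when `M > k` — next file — and nothing when `M = k`).  Decided instances of an
OPEN question (Mantova–Masser, PLMS 2024 §1 p. 5); EC(3,2) OPEN; NOT Schanuel's conjecture
(neither used nor implied); EAC ⇏ SC.
-/

noncomputable section

open Filter Topology Metric Complex
open Literature.NumberTheory.Transcendental Literature.ModelTheory.Zilber
open Literature.ModelTheory.ExponentialFields

set_option linter.dupNamespace false

namespace Summit.Schanuel.Schanuel.Theorems

/-! ## Part A. The growth ratio along a scaled sequence -/

/-- **Growth ratio for `x_m = e^{α t_m}·B_m`** with `α > 0`, `t_m → +∞`, `B_m → B₀`, `Re B₀ ≠ 0`: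
`|Re x_m| / log(2 + ‖x_m‖) → ∞`. [folklore] -/
theorem tendsto_growth_ratio_of_scaled {α : ℝ} (hα : 0 < α) {t : ℕ → ℝ}
    (ht : Tendsto t atTop atTop) {B : ℕ → ℂ} {B₀ : ℂ} (hB : Tendsto B atTop (𝓝 B₀))
    (hB₀ : B₀.re ≠ 0) {x : ℕ → ℂ} (hx : ∀ m, x m = (Real.exp (α * t m) : ℂ) * B m) :
    Tendsto (fun m => |(x m).re| / Real.log (2 + ‖x m‖)) atTop atTop := by
  set b : ℝ := ‖B₀‖ with hb
  set c : ℝ := |B₀.re| with hc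
  have hc0 : 0 < c := abs_pos.2 hB₀
  -- eventually `|Re B_m| ≥ c/2` and `‖B_m‖ ≤ b + 1`
  have hBre : ∀ᶠ m in atTop, c / 2 ≤ |(B m).re| := by
    have h := (Complex.continuous_re.tendsto B₀).comp hB
    have h' := (Metric.tendsto_nhds.1 h) (c / 2) (by positivity)
    filter_upwards [h'] with m hm
    rw [Function.comp_apply, Real.dist_eq] at hm
    have := abs_sub_abs_le_abs_sub (B₀.re) ((B m).re)
    rw [abs_sub_comm] at this
    rw [hc] at hm ⊢
    linarith
  have hBnorm : ∀ᶠ m in atTop, ‖B m‖ ≤ b + 1 := by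
    have h' := (Metric.tendsto_nhds.1 hB) 1 one_pos
    filter_upwards [h'] with m hm
    rw [dist_eq_norm] at hm
    have := norm_le_norm_add_norm_sub' (B m) B₀
    linarith
  -- comparison sequence `c·e^{αt}/(4αt) → ∞`
  have hαt : Tendsto (fun m => α * t m) atTop atTop := ht.const_mul_atTop hα
  have hcmp : Tendsto (fun m => c / 4 * (Real.exp (α * t m) / (α * t m))) atTop atTop := by
    refine Tendsto.const_mul_atTop (by positivity) ?_
    have h := (Real.tendsto_exp_div_pow_atTop 1).comp hαt
    refine h.congr fun m => ?_
    simp [Function.comp_apply, pow_one]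
  refine tendsto_atTop_mono' _ ?_ hcmp
  filter_upwards [hBre, hBnorm, ht.eventually (eventually_ge_atTop 0),
    hαt.eventually (eventually_ge_atTop (Real.log (b + 3)))] with m hre hnorm ht0 htlog
  set X : ℝ := Real.exp (α * t m) with hX
  have hX0 : 0 < X := Real.exp_pos _
  have hX1 : 1 ≤ X := by
    rw [hX]
    exact Real.one_le_exp (by positivity)
  have hxre : (x m).re = X * (B m).re := by
    rw [hx m, Complex.re_ofReal_mul]
  have hxnorm : ‖x m‖ = X * ‖B m‖ := by
    rw [hx m, norm_mul, Complex.norm_real, Real.norm_eq_abs, abs_of_pos hX0]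
  -- numerator
  have hnum : c / 2 * X ≤ |(x m).re| := by
    rw [hxre, abs_mul, abs_of_pos hX0]
    nlinarith
  -- denominator
  have hb0 : 0 ≤ b := norm_nonneg _
  have hden1 : Real.log (2 + ‖x m‖) ≤ α * t m + Real.log (b + 3) := by
    have h1 : 2 + ‖x m‖ ≤ X * (b + 3) := by
      rw [hxnorm]
      have : X * ‖B m‖ ≤ X * (b + 1) := mul_le_mul_of_nonneg_left hnorm hX0.le
      nlinarith
    calc Real.log (2 + ‖x m‖) ≤ Real.log (X * (b + 3)) :=
          Real.log_le_log (by positivity) h1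
      _ = α * t m + Real.log (b + 3) := by
          rw [Real.log_mul hX0.ne' (by positivity), hX, Real.log_exp]
  have hden2 : Real.log (2 + ‖x m‖) ≤ 2 * (α * t m) := by linarith
  have hdenpos : 0 < Real.log (2 + ‖x m‖) :=
    Real.log_pos (by linarith [norm_nonneg (x m)])
  have hαt0 : 0 < α * t m := by
    have : 0 < Real.log (b + 3) := Real.log_pos (by linarith)
    linarith
  calc c / 4 * (Real.exp (α * t m) / (α * t m)) = c / 2 * X / (2 * (α * t m)) := by
        rw [hX]; field_simp; ring
    _ ≤ c / 2 * X / Real.log (2 + ‖x m‖) :=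
        div_le_div_of_nonneg_left (by positivity) hdenpos hden2
    _ ≤ |(x m).re| / Real.log (2 + ‖x m‖) := div_le_div_of_nonneg_right hnum hdenpos.le

/-- **Second-order Taylor bound** for a function analytic at `0`:
`‖g(ε) − g(0) − g′(0)ε‖ ≤ C‖ε‖²` for `‖ε‖ < δ` (via `dslope` twice). [folklore] -/
theorem exists_taylor_two_bound {g : ℂ → ℂ} (hg : AnalyticAt ℂ g 0) :
    ∃ C δ : ℝ, 0 < C ∧ 0 < δ ∧ ∀ ε : ℂ, ‖ε‖ < δ → ‖g ε - g 0 - deriv g 0 * ε‖ ≤ C * ‖ε‖ ^ 2 := by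
  obtain ⟨p, hp⟩ := hg
  have h1 : AnalyticAt ℂ (dslope g 0) 0 := ⟨_, hp.has_fpower_series_dslope_fslope⟩
  obtain ⟨p1, hp1⟩ := h1
  have h2 : AnalyticAt ℂ (dslope (dslope g 0) 0) 0 := ⟨_, hp1.has_fpower_series_dslope_fslope⟩
  -- `dslope (dslope g 0) 0` is bounded near `0`
  obtain ⟨δ, hδ0, hbd⟩ : ∃ δ > 0, ∀ ε : ℂ, ‖ε‖ < δ →
      ‖dslope (dslope g 0) 0 ε - dslope (dslope g 0) 0 0‖ < 1 := by
    obtain ⟨δ, hδ0, h⟩ := (Metric.continuousAt_iff.1 h2.continuousAt) 1 one_pos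
    exact ⟨δ, hδ0, fun ε hε => by rw [← dist_eq_norm]; exact h (by rwa [dist_zero_right])⟩
  refine ⟨‖dslope (dslope g 0) 0 0‖ + 1, δ, by positivity, hδ0, fun ε hε => ?_⟩
  have e1 : g ε - g 0 = ε * dslope g 0 ε := by
    have := sub_smul_dslope g 0 ε
    rw [sub_zero, smul_eq_mul] at this
    exact this.symm
  have e2 : dslope g 0 ε - dslope g 0 0 = ε * dslope (dslope g 0) 0 ε := by
    have := sub_smul_dslope (dslope g 0) 0 ε
    rw [sub_zero, smul_eq_mul] at this
    exact this.symm
  have e3 : g ε - g 0 - deriv g 0 * ε = ε ^ 2 * dslope (dslope g 0) 0 ε := by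
    rw [← dslope_same g 0, e1]
    have : dslope g 0 ε = dslope g 0 0 + ε * dslope (dslope g 0) 0 ε := by rw [← e2]; ring
    rw [this]
    ring
  rw [e3, norm_mul, norm_pow, mul_comm]
  refine mul_le_mul_of_nonneg_right ?_ (by positivity)
  have := norm_le_norm_add_norm_sub' (dslope (dslope g 0) 0 ε) (dslope (dslope g 0) 0 0)
  linarith [hbd ε hε]

/-- **Growth ratio from exponential bounds**: if `t_m → ∞`, `|Re x_m| ≥ c·e^{α t_m}` (`α, c > 0`)
and `‖x_m‖ ≤ e^{β t_m}` eventually (`β ≥ 0`), then `|Re x_m| / log(2 + ‖x_m‖) → ∞`. [folklore] -/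
theorem tendsto_growth_ratio_of_exp_bounds {α β c : ℝ} (hα : 0 < α) (hβ : 0 ≤ β) (hc : 0 < c)
    {t : ℕ → ℝ} (ht : Tendsto t atTop atTop) {x : ℕ → ℂ}
    (hre : ∀ᶠ m in atTop, c * Real.exp (α * t m) ≤ |(x m).re|)
    (hnorm : ∀ᶠ m in atTop, ‖x m‖ ≤ Real.exp (β * t m)) :
    Tendsto (fun m => |(x m).re| / Real.log (2 + ‖x m‖)) atTop atTop := by
  have hαt : Tendsto (fun m => α * t m) atTop atTop := ht.const_mul_atTop hα
  have hcmp : Tendsto (fun m => c * α / (β + 2) * (Real.exp (α * t m) / (α * t m))) atTop atTop := by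
    refine Tendsto.const_mul_atTop (by positivity) ?_
    have h := (Real.tendsto_exp_div_pow_atTop 1).comp hαt
    refine h.congr fun m => ?_
    simp [Function.comp_apply, pow_one]
  refine tendsto_atTop_mono' _ ?_ hcmp
  filter_upwards [hre, hnorm, ht.eventually (eventually_ge_atTop 1)] with m hre' hnorm' ht1
  have hden1 : Real.log (2 + ‖x m‖) ≤ β * t m + Real.log 3 := by
    have h1 : 2 + ‖x m‖ ≤ 3 * Real.exp (β * t m) := by
      have := Real.one_le_exp (by positivity : 0 ≤ β * t m)
      linarith
    calc Real.log (2 + ‖x m‖) ≤ Real.log (3 * Real.exp (β * t m)) :=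
          Real.log_le_log (by positivity) h1
      _ = β * t m + Real.log 3 := by
          rw [Real.log_mul (by norm_num) (Real.exp_pos _).ne', Real.log_exp]; ring
  have hlog3 : Real.log 3 ≤ 2 := by
    have := Real.log_le_sub_one_of_pos (by norm_num : (0 : ℝ) < 3)
    linarith
  have hden2 : Real.log (2 + ‖x m‖) ≤ (β + 2) * t m := by nlinarith
  have hdenpos : 0 < Real.log (2 + ‖x m‖) := Real.log_pos (by linarith [norm_nonneg (x m)])
  have hαt1 : 0 < α * t m := by positivity
  calc c * α / (β + 2) * (Real.exp (α * t m) / (α * t m))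
        = c * Real.exp (α * t m) / ((β + 2) * t m) := by field_simp
    _ ≤ c * Real.exp (α * t m) / Real.log (2 + ‖x m‖) :=
        div_le_div_of_nonneg_left (by positivity) hdenpos hden2
    _ ≤ |(x m).re| / Real.log (2 + ‖x m‖) := div_le_div_of_nonneg_right hre' hdenpos.le

/-! ## Part B. Density of pole / zero fibres in a good direction -/

/-- **Pole and zero fibre values in a good direction.**  A cylinder germ
`(s^{-k}, Φ(s)s^{-M}, ψ(s)s^L, e^{x₁})` (`k, M ≥ 1`, `L ∈ ℤ`, `ψ(0) ≠ 0`) in an irreducible closed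
`S` of dimension `≤ 2` with `Re(Φ(0)·z^M) ≠ 0` for SOME `k`-th root `z` of `2πi` gives Zariski-dense
exponential points: along the points of file XXXI on the sheet with tangent `z`,
`Re x₁ = n^{M/k}(Re(Φ(0)z^M) + o(1))` against `log ‖x₁‖ = O(log n)`, and THEOREM G applies.
[cite: MantovaMasser2023, §1 Further remarks, p. 5 (the question, open in general)] (new) -/
theorem unprojectedDense_branch_poleFibre_of_exists_direction {S : Set (Fin 2 ⊕ Fin 2 → ℂ)}
    (hS : IsIrreducibleClosed ℂ S) (hdim : zariskiDim ℂ S ≤ (2 : ℕ))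
    {k M : ℕ} (hk : 1 ≤ k) (hM : 1 ≤ M) (L : ℤ) {ψ : ℂ → ℂ} (hψ : AnalyticAt ℂ ψ 0)
    (hψ0 : ψ 0 ≠ 0) {Φ : ℂ → ℂ} (hΦ : AnalyticAt ℂ Φ 0)
    (hdir : ∃ z : ℂ, z ^ k = 2 * Real.pi * I ∧ (Φ 0 * z ^ M).re ≠ 0)
    (hgerm : ∀ᶠ s in 𝓝[≠] (0 : ℂ),
      (Sum.elim ![(s ^ k)⁻¹, Φ s * (s ^ M)⁻¹] ![ψ s * s ^ L, Complex.exp (Φ s * (s ^ M)⁻¹)] :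
        Fin 2 ⊕ Fin 2 → ℂ) ∈ S) :
    UnprojectedDense S := by
  classical
  obtain ⟨z, hz, hzre⟩ := hdir
  have hk0 : k ≠ 0 := by omega
  have hkC : (k : ℂ) ≠ 0 := Nat.cast_ne_zero.2 hk0
  have h2πI : (2 * Real.pi * I : ℂ) ≠ 0 := by simp [Real.pi_ne_zero, Complex.I_ne_zero]
  have hz0 : z ≠ 0 := by
    rintro rfl
    rw [zero_pow hk0] at hz
    exact h2πI hz.symm
  obtain ⟨N₀, u, s, -, -, hN₀, hu, hu0, -, -, hsu, hs0, hs, hexp⟩ :=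
    exists_poleFibre_expPoints hk L hψ hψ0 hz
  -- the points lie in `S` eventually
  have hsW : Tendsto s atTop (𝓝[≠] (0 : ℂ)) :=
    tendsto_nhdsWithin_iff.2 ⟨hs, Eventually.of_forall hs0⟩
  obtain ⟨J₀, hJ₀⟩ := Filter.eventually_atTop.1 (hsW.eventually hgerm)
  set p : ℕ → Fin 2 ⊕ Fin 2 → ℂ := fun m =>
    Sum.elim ![(s (J₀ + m) ^ k)⁻¹, Φ (s (J₀ + m)) * (s (J₀ + m) ^ M)⁻¹]
      ![ψ (s (J₀ + m)) * s (J₀ + m) ^ L, Complex.exp (Φ (s (J₀ + m)) * (s (J₀ + m) ^ M)⁻¹)]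
    with hp
  have hpS : ∀ m, p m ∈ S := fun m => hJ₀ (J₀ + m) (Nat.le_add_right _ _)
  have hpΓ : ∀ m, p m ∈ expGraph ℂ 2 := by
    intro m
    rw [mem_expGraph_iff]
    intro i
    rw [Literature.ModelTheory.ExponentialFields.ExponentialRing.complex_exp_eq]
    fin_cases i
    · simp [hp, hexp (J₀ + m)]
    · simp [hp]
  -- the scaled form of `x₁`
  set α : ℝ := (M : ℝ) / k with hα
  have hα0 : 0 < α := by rw [hα]; positivity
  set t : ℕ → ℝ := fun m => Real.log ((N₀ + (J₀ + m) : ℕ) : ℝ) with ht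
  have htt : Tendsto t atTop atTop := by
    rw [ht]
    refine Real.tendsto_log_atTop.comp (tendsto_natCast_atTop_atTop.comp ?_)
    exact (tendsto_add_atTop_nat (N₀ + J₀)).congr fun m => by omega
  set B : ℕ → ℂ := fun m => Φ (s (J₀ + m)) * z ^ M * (u (J₀ + m) ^ M)⁻¹ with hB
  have hBt : Tendsto B atTop (𝓝 (Φ 0 * z ^ M * (1 ^ M)⁻¹)) := by
    have hsJ : Tendsto (fun m => s (J₀ + m)) atTop (𝓝 0) :=
      hs.comp ((tendsto_add_atTop_nat J₀).congr fun m => by ring)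
    have huJ : Tendsto (fun m => u (J₀ + m)) atTop (𝓝 1) :=
      hu.comp ((tendsto_add_atTop_nat J₀).congr fun m => by ring)
    have hΦs : Tendsto (fun m => Φ (s (J₀ + m))) atTop (𝓝 (Φ 0)) :=
      hΦ.continuousAt.tendsto.comp hsJ
    exact (hΦs.mul tendsto_const_nhds).mul ((huJ.pow M).inv₀ (by simp))
  rw [one_pow, inv_one, mul_one] at hBt
  have hx : ∀ m, p m (Sum.inl 1) = (Real.exp (α * t m) : ℂ) * B m := by
    intro m
    simp only [hp, hB, ht, hα, Sum.elim_inl, Matrix.cons_val_one, Matrix.cons_val_zero]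
    rw [hsu (J₀ + m)]
    have hE : (Complex.exp (-(Real.log ((N₀ + (J₀ + m) : ℕ) : ℝ) : ℂ) / k) ^ M)⁻¹ =
        (Real.exp ((M : ℝ) / k * Real.log ((N₀ + (J₀ + m) : ℕ) : ℝ)) : ℂ) := by
      rw [← Complex.exp_nat_mul, ← Complex.exp_neg, Complex.ofReal_exp]
      congr 1
      push_cast
      field_simp
    rw [mul_pow, mul_pow, mul_inv, mul_inv, inv_pow, inv_inv, hE]
    ring
  have hgr := tendsto_growth_ratio_of_scaled hα0 htt hBt hzre hx
  exact unprojectedDense_of_growth hS hdim 1 hpS hpΓ hgr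

/-- **Pole and zero fibre values, NO direction condition when `k ∤ 2M`** (`Φ(0) ≠ 0`): a good
`k`-th root of `2πi` always exists (file XIX). [cite: MantovaMasser2023, §1 Further remarks,
p. 5 (the question, open in general)] (new) -/
theorem unprojectedDense_branch_poleFibre_of_not_dvd {S : Set (Fin 2 ⊕ Fin 2 → ℂ)}
    (hS : IsIrreducibleClosed ℂ S) (hdim : zariskiDim ℂ S ≤ (2 : ℕ))
    {k M : ℕ} (hk : 1 ≤ k) (hM : 1 ≤ M) (hkM : ¬ k ∣ 2 * M) (L : ℤ) {ψ : ℂ → ℂ}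
    (hψ : AnalyticAt ℂ ψ 0) (hψ0 : ψ 0 ≠ 0) {Φ : ℂ → ℂ} (hΦ : AnalyticAt ℂ Φ 0) (hΦ0 : Φ 0 ≠ 0)
    (hgerm : ∀ᶠ s in 𝓝[≠] (0 : ℂ),
      (Sum.elim ![(s ^ k)⁻¹, Φ s * (s ^ M)⁻¹] ![ψ s * s ^ L, Complex.exp (Φ s * (s ^ M)⁻¹)] :
        Fin 2 ⊕ Fin 2 → ℂ) ∈ S) :
    UnprojectedDense S :=
  unprojectedDense_branch_poleFibre_of_exists_direction hS hdim hk hM L hψ hψ0 hΦ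
    (exists_direction_of_not_dvd hk hkM hΦ0) hgerm

/-- **Pole and zero fibre values over a branch with direction `Φ(0) = 1`, off the residue class**
`k ∣ 2M ∧ 2M/k ≡ 2 (mod 4)` (file XX's `exists_direction_powerCurve`).
[cite: MantovaMasser2023, §1 Further remarks, p. 5 (the question, open in general)] (new) -/
theorem unprojectedDense_branch_poleFibre_of_not_residue {S : Set (Fin 2 ⊕ Fin 2 → ℂ)}
    (hS : IsIrreducibleClosed ℂ S) (hdim : zariskiDim ℂ S ≤ (2 : ℕ))
    {k M : ℕ} (hk : 1 ≤ k) (hM : 1 ≤ M) (hres : ¬ (k ∣ 2 * M ∧ (2 * M / k) % 4 = 2)) (L : ℤ)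
    {ψ : ℂ → ℂ} (hψ : AnalyticAt ℂ ψ 0) (hψ0 : ψ 0 ≠ 0) {Φ : ℂ → ℂ} (hΦ : AnalyticAt ℂ Φ 0)
    (hΦ0 : Φ 0 = 1)
    (hgerm : ∀ᶠ s in 𝓝[≠] (0 : ℂ),
      (Sum.elim ![(s ^ k)⁻¹, Φ s * (s ^ M)⁻¹] ![ψ s * s ^ L, Complex.exp (Φ s * (s ^ M)⁻¹)] :
        Fin 2 ⊕ Fin 2 → ℂ) ∈ S) :
    UnprojectedDense S := by
  obtain ⟨z, hz, hzre⟩ := exists_direction_powerCurve hk hres (M := M)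
  exact unprojectedDense_branch_poleFibre_of_exists_direction hS hdim hk hM L hψ hψ0 hΦ
    ⟨z, hz, by rw [hΦ0, one_mul]; exact hzre⟩ hgerm

end Summit.Schanuel.Schanuel.Theorems

end
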